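import Summits.BirchSwinnertonDyer.BirchSwinnertonDyer.Theorems.SmallImageMuTransferMuTransferX9KolyvaginCocycleValue
import Summits.BirchSwinnertonDyer.BirchSwinnertonDyer.Theorems.ByReductionTypeAtTwoOrdKatoHalfAtTwoIsoKolyvaginRealComponent
import Summits.BirchSwinnertonDyer.BirchSwinnertonDyer.Theorems.ByReductionTypeAtTwoOrdKatoHalfAtTwoIsoKolyvaginRealCoset
import HarnessLib

/-!
# Route ByReductionTypeAtTwo, crux `OrdKatoHalfAtTwoIso` (stmt-BirchSwinnertonDyer-19573), line `steinberg-fibre-at-two`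
# (skeleton v11), stub `stub_coreA_posDisc : CoreTheoremAPosDiscTwo` — plan item (P2): THE KOLYVAGIN COCYCLE OF THE Ω ROAD
# WITH ITS VALUE **AND ITS VANISHING AT AN INVOLUTION OUTSIDE `Gal(ℚ̄/ℚ(μ_ℓ))`** (the real component, `ℓ ≡ 1 (mod 4)`)

Seat `cruxlead-stmt-BirchSwinnertonDyer-19573-g5` (LEAD PROVER, MODE LINE; HOME `run/shared/lean/pub/bsd-2adic/`; `--supports`
stmt-BirchSwinnertonDyer-19573 as helper). THEOREMS ONLY (no definition, no named fact, no `sorry`); `p`-generic like its parent.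
HONEST FRAMING (cell bsd-2adic): BSD is not proved by any of this; the crux and the stub are NOT proved here.

WHY. `exists_kolyvaginCocycle_value_noTransverse` (p661924) — the interior step (E)/M1 of the Ω road's H-K — DISCARDS the class-level
output `res [Φ] = Σ_{i<ℓ−1} i • σ^i·[y]` of `KolyvaginTwist.exists_kolyvaginCocycle`. The `0 < Δ` twin of H-K (brief (P4)) needs
exactly that output to kill the real component of `Φ`: by `kolyvaginCocycle_apply_eq_zero_of_even` (p687273) `Φ(c) = 0` for every
involution `c` acting trivially on `𝒯_J` in the coset `σ^{(ℓ−1)/2} N` when `(ℓ−1)/2` is even, and a complex conjugation is such an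
involution at `0 < Δ` (`…RealPlacePosDisc`, p686322; `…KolyvaginRealCoset`: `c ∉ N` ⇒ middle coset). This file re-runs the
parent's proof VERBATIM (credit x10 / wave-4 worker / k6-g3) keeping that output, and appends the clause. The downstream package
`exists_kolyvaginPackage_two` (p664682) can be re-exported over this theorem with the extra clause «`∀` complex conjugation `c`,
`4 ∣ ℓ − 1 →` `c(res …)`… `Φ.1 c = 0`» (next file), feeding `hxinf` of `convCoeff_eq_zero_of_qTermIdentity_modPTwist_two_of_xinf`.

References: K. Rubin, *Euler Systems* (2000) §4.4, Thm. 4.5.1 [Rubin2000]; B. Perrin-Riou, Ann. Inst. Fourier 48 (1998) §3.1.2,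
Prop. 3.1.6 [PerrinRiou1998AIF]; J. Tate, Corvallis (1979) (1.4.1) [TateCorvallis1979]; tree p661924 (parent, verbatim), p687273,
`…KolyvaginRealCoset.lean`, HOME/koly/MU-TRANSFER-PROOF.md §3.
-/

-- the summit and its single problem are both named `BirchSwinnertonDyer` (registry layout D-0017)
set_option linter.dupNamespace false
set_option autoImplicit false

noncomputable section

open CategoryTheory Function Finset
open scoped NumberField Pointwise
open Field IsDedekindDomain NumberField
open Literature.NumberTheory.GaloisRepresentations
open Literature.NumberTheory.GaloisRepresentations.IsNonarchimedeanLocalField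
open Literature.NumberTheory.EllipticCurves
open Literature.NumberTheory.EllipticCurves.ZpExtension
open Rat.HeightOneSpectrum
open Summit.BirchSwinnertonDyer.Rank1Residual.GaloisImage
open Summit.BirchSwinnertonDyer.Rank1Residual.GaloisImage.CyclotomicLevel.Rat

namespace Summit.BirchSwinnertonDyer.BirchSwinnertonDyer.Rank1Residual.KolyvaginTwist

variable {p : ℕ} [Fact p.Prime] {M : Type} [AddCommGroup M] [TopologicalSpace M]
  [DiscreteTopology M] (κ : ZpExtension ℚ p) (ρ : DiscreteGaloisModule ℚ M)
  (hM : ∀ m : M, p • m = 0) (J : ℕ)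

/-- **THE KOLYVAGIN COCYCLE AT THE MEETING POINT WITH ITS VALUE — AND ITS VANISHING AT THE REAL PLACE** (lead g5;
plan item (P2) of `STUB-BRIEF-stub_coreA_posDisc.md`). Verbatim `exists_kolyvaginCocycle_value_noTransverse` (p661924:
the tame generator `σ`, `τq`, the Kolyvagin cocycle `Φ` of `y = y' mod T^J` with `hx`, `Φ = 0` on `N ∩ ℐ_{𝔓₀}`, the local
Frobenius `r`, the key relation), with ONE MORE OUTPUT CLAUSE on the same `Φ`: for every involution `c` (`c² = 1`) that is
NOT in `N = Gal(ℚ̄/ℚ(μ_ℓ))` and acts TRIVIALLY on `𝒯_J`, if `2·𝒯_J = 0` and `4 ∣ ℓ − 1`, then **`Φ(c) = 0`**. For a complex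
conjugation `c` at `0 < Δ` (trivial on `E[2]`: `smul_eq_self_of_isComplexConjugation_of_Δ_pos`, p686322; `χ_ℓ(c) = −1`:
`not_mem_rootsOfUnityFixer_of_isComplexConjugation`) this is the vanishing of the REAL COMPONENT of the Kolyvagin class of a
Kolyvagin prime `ℓ ≡ 1 (mod 4)` — the hypothesis `hxinf` of Step 4 (`…StepFourOfXInf.lean`, p685843) at `k = 0`. Proof of
the new clause: `c ∈ σ^k N` with `ℓ − 1 = k + k` (`exists_half_of_mul_self_of_not_mem`), `k` even, the retained fourth
output `res [Φ] = Σ i • σ^i·[y]` of `exists_kolyvaginCocycle`, and `kolyvaginCocycle_apply_eq_zero_of_even` (p687273).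
[cite: Rubin2000, Def. 4.4.4, Lemma 4.4.2 and Thm. 4.5.1] [cite: PerrinRiou1998AIF, §3.1.2 and Prop. 3.1.6] -/
theorem exists_kolyvaginCocycle_value_noTransverse_realZero (q : HeightOneSpectrum (𝓞 ℚ))
    [NeZero ((primesEquiv q : Nat.Primes) : ℕ)] [Fact (((primesEquiv q : Nat.Primes) : ℕ)).Prime]
    [NeZero ((((primesEquiv q : Nat.Primes) : ℕ) : ℕ) : q.adicCompletion ℚ)]
    [hNn : (rootsOfUnityFixer ℚ ((primesEquiv q : Nat.Primes) : ℕ)).Normal]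
    [Fintype (absoluteGaloisGroup ℚ ⧸ rootsOfUnityFixer ℚ ((primesEquiv q : Nat.Primes) : ℕ))]
    (hfix : ∀ m : M,
      (∀ g ∈ rootsOfUnityFixer ℚ ((primesEquiv q : Nat.Primes) : ℕ), ρ g m = m) → m = 0)
    (hpq : (p : 𝓞 ℚ) ∉ q.asIdeal) (hunr : GaloisRep.IsUnramifiedAt q ρ)
    (hdvd : p ∣ ((primesEquiv q : Nat.Primes) : ℕ) - 1)
    {L : ℕ} (hJL : J ≤ L)
    (y' : contOneCocycles (subgroupRep (κ.twistModP ρ hM L).toTopRep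
      (rootsOfUnityFixer ℚ ((primesEquiv q : Nat.Primes) : ℕ))))
    (hyI' : ∀ w : HeightOneSpectrum (𝓞 ℚ), (p : 𝓞 ℚ) ∉ w.asIdeal → ∀ 𝔓 ∈ w.primesAbove,
      resLe (κ.twistModP ρ hM L).toTopRep
        (inf_le_left : rootsOfUnityFixer ℚ ((primesEquiv q : Nat.Primes) : ℕ) ⊓
          𝔓.inertia (absoluteGaloisGroup ℚ) ≤ _) 1 (oneCocycleClass _ y') = 0)
    (ψ' : contOneCocycles (κ.twistModP ρ hM L).toTopRep)
    (hnorm : cores (κ.twistModP ρ hM L).toTopRep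
        (rootsOfUnityFixer ℚ ((primesEquiv q : Nat.Primes) : ℕ))
        (isOpen_rootsOfUnityFixer ℚ _) (oneCocycleClass _ y') = oneCocycleClass _ ψ')
    (hψJ : ∀ (g : absoluteGaloisGroup ℚ) (i : Fin J), ψ'.1 g (Fin.castLE hJL i) = 0) :
    ∃ σ ∈ (adicCompletionPrime ℚ q).inertia (absoluteGaloisGroup ℚ),
      ∃ τq ∈ absInertia (q.adicCompletion ℚ),
      absGaloisRestrict ℚ (q.adicCompletion ℚ) τq = σ ∧
      (∀ u : (ZMod ((primesEquiv q : Nat.Primes) : ℕ))ˣ,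
        u ∈ Subgroup.zpowers (modPCyclotomicCharacterZMod (q.adicCompletion ℚ)
          ((primesEquiv q : Nat.Primes) : ℕ) τq)) ∧
      (∀ x : Fin J → M, κ.twistModP ρ hM J σ x = x) ∧
      ∃ Φ : contOneCocycles (κ.twistModP ρ hM J).toTopRep,
        (∀ w : HeightOneSpectrum (𝓞 ℚ), w ≠ q → (p : 𝓞 ℚ) ∉ w.asIdeal →
          GaloisRep.IsUnramifiedAt w ρ →
          galoisCohomology.localization (κ.twistModP ρ hM J) (Sum.inr w) 1 (oneCocycleClass _ Φ) ∈
            DiscreteGaloisModule.unramifiedSubgroup (GaloisRep.toLocal w (κ.twistModP ρ hM J)) 1) ∧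
        (∀ τ ∈ (adicCompletionPrime ℚ q).inertia (absoluteGaloisGroup ℚ),
          τ ∈ rootsOfUnityFixer ℚ ((primesEquiv q : Nat.Primes) : ℕ) → Φ.1 τ = 0) ∧
        (∀ c : absoluteGaloisGroup ℚ, (∀ x : Fin J → M, 2 • x = 0) →
          (∀ x : Fin J → M, κ.twistModP ρ hM J c x = x) → c * c = 1 →
          c ∉ rootsOfUnityFixer ℚ ((primesEquiv q : Nat.Primes) : ℕ) →
          4 ∣ ((primesEquiv q : Nat.Primes) : ℕ) - 1 → Φ.1 c = 0) ∧
        ∃ r : absoluteGaloisGroup (q.adicCompletion ℚ), IsAbsArithFrob r ∧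
          absGaloisRestrict ℚ (q.adicCompletion ℚ) r ∈
            rootsOfUnityFixer ℚ ((primesEquiv q : Nat.Primes) : ℕ) ∧
          ∃ a' : Fin L → M,
            (Φ.1 (absGaloisRestrict ℚ (q.adicCompletion ℚ) τq) = fun i => -a' (Fin.castLE hJL i)) ∧
            κ.twistModP ρ hM L (absGaloisRestrict ℚ (q.adicCompletion ℚ) r) a' - a' =
              -ψ'.1 (absGaloisRestrict ℚ (q.adicCompletion ℚ) r) := by
  have h𝔓₀ := adicCompletionPrime_mem_primesAbove ℚ q
  -- the generator
  obtain ⟨σ, hσI, hσn, hcov, hinj⟩ := exists_generator_mem_inertia q h𝔓₀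
  -- inertia of `𝔓₀` acts trivially, at both levels
  have hIL : ∀ τ ∈ (adicCompletionPrime ℚ q).inertia (absoluteGaloisGroup ℚ), ∀ w : Fin L → M,
      (κ.twistModP ρ hM L).toTopRep.ρ τ w = w := fun τ hτ w =>
    twistModP_apply_eq_self_of_mem_inertia κ ρ hM L hpq hunr h𝔓₀ hτ w
  have hIJ : ∀ τ ∈ (adicCompletionPrime ℚ q).inertia (absoluteGaloisGroup ℚ), ∀ w : Fin J → M,
      (κ.twistModP ρ hM J).toTopRep.ρ τ w = w := fun τ hτ w =>
    twistModP_apply_eq_self_of_mem_inertia κ ρ hM J hpq hunr h𝔓₀ hτ w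
  have hσL : ∀ w : Fin L → M, (κ.twistModP ρ hM L).toTopRep.ρ σ w = w := hIL σ hσI
  have hσJ : ∀ w : Fin J → M, (κ.twistModP ρ hM J).toTopRep.ρ σ w = w := hIJ σ hσI
  -- `X_J^N = 0`, `(ℓ - 1) • X = 0` at both levels
  have h0 := twistModP_eq_zero_of_forall_rootsOfUnityFixer κ ρ hM J _ hfix
  have hnXJ : ∀ w : Fin J → M, ((((primesEquiv q : Nat.Primes) : ℕ) - 1 : ℕ) : ℤ) • w = 0 :=
    fun w => by rw [natCast_zsmul]; exact LocalSplitPrime.sub_one_smul_eq_zero_of_dvd hM hdvd w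
  have hnXL : ∀ w : Fin L → M, ((((primesEquiv q : Nat.Primes) : ℕ) - 1 : ℕ) : ℤ) • w = 0 :=
    fun w => by rw [natCast_zsmul]; exact LocalSplitPrime.sub_one_smul_eq_zero_of_dvd hM hdvd w
  -- `y'` vanishes on `N ∩ ℐ_{𝔓₀}`
  have hy'τ := apply_eq_zero_of_resLe_inf_eq_zero _ _
    ((adicCompletionPrime ℚ q).inertia (absoluteGaloisGroup ℚ)) hIL y' (hyI' q hpq _ h𝔓₀)
  -- the level-`L` norm witness `a'` from the CLASS-LEVEL norm relation
  have h𝒩' : ∑ i ∈ range (((primesEquiv q : Nat.Primes) : ℕ) - 1),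
      conjMap (κ.twistModP ρ hM L).toTopRep (rootsOfUnityFixer ℚ ((primesEquiv q : Nat.Primes) : ℕ))
        (σ ^ i) 1 (oneCocycleClass _ y') =
      resSubgroup (κ.twistModP ρ hM L).toTopRep
        (rootsOfUnityFixer ℚ ((primesEquiv q : Nat.Primes) : ℕ)) 1 (oneCocycleClass _ ψ') := by
    rw [sum_conjMap_pow_eq_resSubgroup_cores _ _ (isOpen_rootsOfUnityFixer ℚ _) hcov hinj, hnorm]
  obtain ⟨a', ha'⟩ := exists_norm_witness_of_sum_conjMap_eq_resSubgroup _ _ σ _ y' ψ' h𝒩'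
  -- truncation `π : 𝒯_L → 𝒯_J`, the truncated cocycle `y = π ∘ y'`
  let π : (κ.twistModP ρ hM L).toTopRep ⟶ (κ.twistModP ρ hM J).toTopRep :=
    TopRep.ofHom ⟨(κ.twistModPTruncate ρ hM L hJL).toContinuousLinearMap,
      (κ.twistModPTruncate ρ hM L hJL).isIntertwining'⟩
  have hπ : ∀ x : Fin L → M, π.hom x = fun i => x (Fin.castLE hJL i) := fun _ => rfl
  let y : contOneCocycles (subgroupRep (κ.twistModP ρ hM J).toTopRep
      (rootsOfUnityFixer ℚ ((primesEquiv q : Nat.Primes) : ℕ))) :=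
    contOneCocycles.pullback (ContinuousMonoidHom.id _)
      (Y := subgroupRep (κ.twistModP ρ hM J).toTopRep
        (rootsOfUnityFixer ℚ ((primesEquiv q : Nat.Primes) : ℕ)))
      (TopRep.ofHom ⟨π.hom.toContinuousLinearMap, fun g =>
        π.hom.isIntertwining' (g : absoluteGaloisGroup ℚ)⟩) y'
  have hy : ∀ u, y.1 u = π.hom (y'.1 u) := fun _ => rfl
  -- the transported norm witness `a = π a'` (the truncation of `ψ'` vanishes): `𝒩y = ∂(π a')`
  have ha : ∀ u : rootsOfUnityFixer ℚ ((primesEquiv q : Nat.Primes) : ℕ),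
      ∑ i ∈ range (((primesEquiv q : Nat.Primes) : ℕ) - 1),
        (κ.twistModP ρ hM J).toTopRep.ρ (σ ^ i) (y.1 (subgroupConj _ (σ ^ i) u)) =
      (κ.twistModP ρ hM J).toTopRep.ρ (u : absoluteGaloisGroup ℚ) (π.hom a') - π.hom a' := by
    intro u
    have h := norm_witness_map _ _ π σ _ y' (fun u => ψ'.1 u) a' ha' u
    have hψ : π.hom (ψ'.1 u) = 0 := by
      rw [hπ]; funext i; exact hψJ _ i
    rw [hψ, zero_add] at h
    exact h
  -- `y` vanishes on `N ∩ ℐ_{𝔓₀}`, in particular at `σ^{ℓ-1}`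
  have hyτ : ∀ τ : rootsOfUnityFixer ℚ ((primesEquiv q : Nat.Primes) : ℕ),
      (τ : absoluteGaloisGroup ℚ) ∈ (adicCompletionPrime ℚ q).inertia (absoluteGaloisGroup ℚ) →
        y.1 τ = 0 := fun τ hτ => by
    rw [hy, hy'τ τ hτ, map_zero]
  have hyσn : y.1 ⟨σ ^ (((primesEquiv q : Nat.Primes) : ℕ) - 1), hσn⟩ = 0 :=
    hyτ ⟨_, hσn⟩ (Subgroup.pow_mem _ hσI _)
  have hgen : ∀ g : absoluteGaloisGroup ℚ, ∃ i : ℕ,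
      (σ ^ i)⁻¹ * g ∈ rootsOfUnityFixer ℚ ((primesEquiv q : Nat.Primes) : ℕ) := fun g => by
    obtain ⟨i, -, hi⟩ := hcov g; exact ⟨i, hi⟩
  -- the Kolyvagin cocycle of `y` (Lemma 2), value `Φ(σ) = −π a'`
  obtain ⟨Φ, hΦN, hΦσ, hΦres, -⟩ := exists_kolyvaginCocycle _ _ (isOpen_rootsOfUnityFixer ℚ _)
    h0 hσJ hσn hgen hnXJ y hyσn (π.hom a') ha
  -- a local inertia element `τq` over `σ`, a local Frobenius `r` restricting into `N`
  have hσ' : σ ∈ (absInertia (q.adicCompletion ℚ)).map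
      (absGaloisRestrict ℚ (q.adicCompletion ℚ)).toMonoidHom := by
    rw [← inertia_adicCompletionPrime_eq_map_absInertia]; exact hσI
  obtain ⟨τq, hτq, hτqσ⟩ := Subgroup.mem_map.mp hσ'
  obtain ⟨r, hr, hrN⟩ := exists_isAbsArithFrob_absGaloisRestrict_mem q _ hcov hτq hτqσ
  refine ⟨σ, hσI, τq, hτq, hτqσ,
    forall_mem_zpowers_modPCyclotomicCharacterZMod_of_cov q hcov hτqσ, hσJ, Φ,
    fun w hwq hwp hwunr => ?_, fun τ hτI hτN => ?_, fun c h2X hcX hcc hcN h4 => ?_, r, hr, hrN, a', ?_, ?_⟩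
  · -- `hx`: unramified at `w ≠ q`, `w ∤ p` (as in p458422, for `y = π ∘ y'`)
    have hwN : ∀ 𝔓 ∈ w.primesAbove, 𝔓.inertia (absoluteGaloisGroup ℚ) ≤
        rootsOfUnityFixer ℚ ((primesEquiv q : Nat.Primes) : ℕ) :=
      rootsOfUnityFixer_unramifiedAt_of_not_mem ℚ _ (natCast_primesEquiv_not_mem_of_ne hwq)
    have hXw : ∀ 𝔓 ∈ w.primesAbove, ∀ τ ∈ 𝔓.inertia (absoluteGaloisGroup ℚ),
        ∀ x : (κ.twistModP ρ hM L).toTopRep, (κ.twistModP ρ hM L).toTopRep.ρ τ x = x :=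
      fun 𝔓 h𝔓 τ hτ x => twistModP_apply_eq_self_of_mem_inertia κ ρ hM L hwp hwunr h𝔓 hτ x
    have hy'w := forall_primesAbove_apply_eq_zero_of_resLe_inf_eq_zero _ _ hwN hXw y' (hyI' w hwp)
    have hyw : ∀ 𝔓 (h𝔓 : 𝔓 ∈ w.primesAbove) (τ : absoluteGaloisGroup ℚ)
        (hτ : τ ∈ 𝔓.inertia (absoluteGaloisGroup ℚ)), y.1 ⟨τ, hwN 𝔓 h𝔓 hτ⟩ = 0 :=
      fun 𝔓 h𝔓 τ hτ => by rw [hy, hy'w 𝔓 h𝔓 τ hτ, map_zero]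
    exact localization_mem_unramifiedSubgroup_of_forall_inertia_apply_eq_zero (κ.twistModP ρ hM J)
      w Φ fun τ hτ => derivCocycle_apply_eq_zero_of_forall_primesAbove _ _ hwN σ _ y hyw Φ hΦN
        (adicCompletionPrime_mem_primesAbove ℚ w) hτ
  · -- vanishing on `N ∩ ℐ_{𝔓₀}` (every `p`): the `σ`-conjugates of `τ` stay in `N ∩ ℐ_{𝔓₀}`
    refine derivCocycle_apply_eq_zero _ _ σ _ y Φ hΦN ⟨τ, hτN⟩ fun i => hyτ _ ?_
    rw [subgroupConj_apply_coe]
    exact Subgroup.mul_mem _ (Subgroup.mul_mem _ (Subgroup.inv_mem _ (Subgroup.pow_mem _ hσI i))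
      hτI) (Subgroup.pow_mem _ hσI i)
  · -- NEW (lead g5, stub_coreA_posDisc (P2)): the REAL COMPONENT VANISHES — `Φ(c) = 0` for an involution `c ∉ N` acting
    -- trivially on `𝒯_J` when `4 ∣ ℓ − 1` (`c` a complex conjugation at `0 < Δ`, Kolyvagin primes `ℓ ≡ 1 (mod 4)`)
    obtain ⟨k, hk, hkc⟩ := exists_half_of_mul_self_of_not_mem hσn hcov hinj hcc hcN
    have hkeven : Even k := by
      rw [hk] at h4
      rcases Nat.even_or_odd k with hke | hko
      · exact hke
      · exfalso
        obtain ⟨j, rfl⟩ := hko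
        omega
    have h2cls : ∀ η : continuousCohomology 1 (subgroupRep (κ.twistModP ρ hM J).toTopRep
        (rootsOfUnityFixer ℚ ((primesEquiv q : Nat.Primes) : ℕ))), 2 • η = 0 := fun η => by
      obtain ⟨w, rfl⟩ := oneCocycleClass_surjective _ η
      have hw : (2 : ℕ) • w = 0 := by
        rw [two_nsmul]
        apply Subtype.ext
        ext g i
        have h := congrFun (h2X (w.1 g)) i
        rw [two_nsmul, Pi.add_apply, Pi.zero_apply] at h
        simpa only [Submodule.coe_add, ContinuousMap.add_apply, Pi.add_apply, Submodule.coe_zero,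
          ContinuousMap.zero_apply, Pi.zero_apply] using h
      rw [← oneCocycleClassₗ_apply, ← map_nsmul, hw, map_zero]
    rw [hk] at hΦres
    exact kolyvaginCocycle_apply_eq_zero_of_even _ _ h0 h2cls hkeven y Φ hΦres hcX hcc hkc
  · -- the value at `res τq = σ`: `Φ(σ) = −π a'`
    change Φ.1 ((absGaloisRestrict ℚ (q.adicCompletion ℚ)).toMonoidHom τq) = _
    rw [hτqσ, hΦσ, hπ]
    funext i
    rw [Pi.neg_apply]
  · -- the key relation (3.1) at the Frobenius `φ = res r ∈ N`
    have hkill : ∀ i : ℕ,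
        y'.1 ((⟨_, hrN⟩ : rootsOfUnityFixer ℚ ((primesEquiv q : Nat.Primes) : ℕ))⁻¹ *
          subgroupConj _ (σ ^ i) ⟨_, hrN⟩) = 0 := fun i =>
      hy'τ _ (inv_mul_conj_mem_of_normalises
        ((adicCompletionPrime ℚ q).inertia (absoluteGaloisGroup ℚ))
        (fun τ hτ => absGaloisRestrict_normalises_inertia_adicCompletionPrime q r hτ) hσI i)
    have h := rho_sub_eq_of_norm_witness _ _ hσL _ y' (fun u => ψ'.1 u) a' ha' ⟨_, hrN⟩ hkill
    have hn0 : (((primesEquiv q : Nat.Primes) : ℕ) - 1) •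
        y'.1 ⟨absGaloisRestrict ℚ (q.adicCompletion ℚ) r, hrN⟩ = 0 := by
      have := hnXL (y'.1 ⟨absGaloisRestrict ℚ (q.adicCompletion ℚ) r, hrN⟩)
      rwa [natCast_zsmul] at this
    rw [hn0, zero_sub, toTopRep_twistModP_ρ_apply] at h
    exact h

end Summit.BirchSwinnertonDyer.BirchSwinnertonDyer.Rank1Residual.KolyvaginTwist

end
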